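import Summits.Ventures.Crystal3D.Theorems.StickyWulffConstantGenericWallFloorTubeHasPayer
import HarnessLib

/-!
# Counting the tubes: a general filling of a non-chain cell has `≳ ρ²` unsaturated balls in the middle

HONEST FRAMING. Venture `Summits/Ventures/Crystal3D` (cell `crystal3d-full`), helper for the crux
`GenericWallFloor` (stmt-Ventures-19480) of `route-Ventures-StickyWulffConstant`, REGISTERED line `WallLedgerG`,
open stub `stub_twoSlabAdhesion` (general fillings; ARCH v4 «coherent walks in tubes», assembly step (A3)).
Rung credit only; F-C1 not moved.

`card_midPayers_ge`: under the hypotheses of `tube_has_payer` (two-slab cell, non-chain pair via a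
mirror-closed frame set `𝓕 ∋ A₁` avoiding `A₂(Λ₀)`, inputs `KissingGap δ` / `KissingClassification δ` by
name), for every `m : ℕ` with `2·(37 m)² ≤ (ρ − 20)²` the set of MID PAYERS
`{x ∈ X : #contacts ≤ 11, −R₀ − 2 ≤ x₂ ≤ h + R₀ + 3}` has at least `(2m + 1)²` elements: the axes
`(37 i, 37 j)`, `|i|, |j| ≤ m`, lie in the disc of radius `ρ − 20`, each tube yields a payer within horizontal
distance `18` of its axis (`tube_has_payer`), and payers of different axes differ (`37 > 2·18`).
`card_midPayers_ge_real`: the same as `(2(ρ − 20)/53 − 1)² ≤ #midPayers` for `ρ ≥ 47`.  This is the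
areal lower bound `≳ ρ²/702` on the contact deficiency of ANY filling between two non-chain grains; the
remaining step to the two-slab inequality is the face/payer ledger (GeneralLedger pattern with mid payers).
WHAT THIS IS NOT: not the stub; F-C1 not moved.
-/

noncomputable section

namespace Summit.Ventures.Crystal3D.Theorems

open Summit.Ventures.Crystal3D Finset
open Literature.MathematicalPhysics.StatisticalMechanics (fccStacking)
open scoped InnerProductSpace

open scoped Classical in
/-- **Tube count.**  See the module docstring. -/
theorem card_midPayers_ge {δ : ℝ} (hg : KissingGap δ) (hc : KissingClassification δ)
    (X : Finset (EuclideanSpace ℝ (Fin 3))) (hX : ∀ p ∈ X, ∀ q ∈ X, p ≠ q → 1 ≤ dist p q)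
    (A₁ : EuclideanSpace ℝ (Fin 3) ≃ₗᵢ[ℝ] EuclideanSpace ℝ (Fin 3)) (t₁ : EuclideanSpace ℝ (Fin 3))
    (A₂ : EuclideanSpace ℝ (Fin 3) ≃ₗᵢ[ℝ] EuclideanSpace ℝ (Fin 3)) (t₂ : EuclideanSpace ℝ (Fin 3))
    (P₁ P₂ : Finset (EuclideanSpace ℝ (Fin 3))) (R₀ h ρ : ℝ) (hR₀ : 3 ≤ R₀) (hρ : R₀ ≤ ρ) (hρ20 : 20 ≤ ρ)
    (hh : 0 ≤ h) (hP₁X : P₁ ⊆ X) (hP₂X : P₂ ⊆ X) (hcell : ∀ p ∈ X, p 2 ≤ h + 2 * R₀)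
    (hP₁ : ∀ p, p ∈ P₁ ↔ (p ∈ (fun q => A₁ q + t₁) '' fccStacking 1 (Real.sqrt (2 / 3)) ∧
      -(2 * R₀) ≤ p 2 ∧ p 2 ≤ -R₀ ∧ p 0 ^ 2 + p 1 ^ 2 ≤ ρ ^ 2))
    (hP₂ : ∀ p, p ∈ P₂ ↔ (p ∈ (fun q => A₂ q + t₂) '' fccStacking 1 (Real.sqrt (2 / 3)) ∧
      h + R₀ ≤ p 2 ∧ p 2 ≤ h + 2 * R₀ ∧ p 0 ^ 2 + p 1 ^ 2 ≤ ρ ^ 2))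
    (hclean₂ : ∀ p ∈ X, h + 2 * R₀ - 1 < p 2 → p ∈ (fun q => A₂ q + t₂) '' fccStacking 1 (Real.sqrt (2 / 3)))
    (𝓕 : Set (EuclideanSpace ℝ (Fin 3) ≃ₗᵢ[ℝ] EuclideanSpace ℝ (Fin 3))) (hA₁ : A₁ ∈ 𝓕)
    (havoid : ∀ G ∈ 𝓕, G '' fccStacking 1 (Real.sqrt (2 / 3)) ≠ A₂ '' fccStacking 1 (Real.sqrt (2 / 3)))
    (hclosed : ∀ G ∈ 𝓕, ∀ m : EuclideanSpace ℝ (Fin 3), ‖m‖ = 1 →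
      (∀ w ∈ fccSlots, ⟪G w, m⟫_ℝ = 0 ∨ ⟪G w, m⟫_ℝ = Real.sqrt (2 / 3) ∨ ⟪G w, m⟫_ℝ = -Real.sqrt (2 / 3)) →
      ∀ G' : EuclideanSpace ℝ (Fin 3) ≃ₗᵢ[ℝ] EuclideanSpace ℝ (Fin 3),
        (∀ x, G' x = G x - (2 * ⟪G x, m⟫_ℝ) • m) → G' ∈ 𝓕)
    (m : ℕ) (hm : 2 * (37 * (m : ℝ)) ^ 2 ≤ (ρ - 20) ^ 2) :
    (2 * m + 1) ^ 2 ≤ (X.filter fun x => (X.filter fun q => dist x q = 1).card ≤ 11 ∧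
      -R₀ - 2 ≤ x 2 ∧ x 2 ≤ h + R₀ + 3).card := by
  set PAY := X.filter fun x => (X.filter fun q => dist x q = 1).card ≤ 11 ∧ -R₀ - 2 ≤ x 2 ∧ x 2 ≤ h + R₀ + 3
    with hPAY
  set G : Finset (ℤ × ℤ) := Finset.Icc (-(m : ℤ)) m ×ˢ Finset.Icc (-(m : ℤ)) m with hG
  have hGcard : G.card = (2 * m + 1) ^ 2 := by
    rw [hG, Finset.card_product, Int.card_Icc]
    have : ((m : ℤ) + 1 - -(m : ℤ)).toNat = 2 * m + 1 := by omega
    rw [this]; ring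
  -- every axis of the grid has a payer
  have key : ∀ ij ∈ G, ∃ z ∈ PAY, (z 0 - 37 * (ij.1 : ℝ)) ^ 2 + (z 1 - 37 * (ij.2 : ℝ)) ^ 2 ≤ 18 ^ 2 := by
    intro ij hij
    rw [hG, Finset.mem_product, Finset.mem_Icc, Finset.mem_Icc] at hij
    obtain ⟨⟨hi1, hi2⟩, ⟨hj1, hj2⟩⟩ := hij
    have hi : ((ij.1 : ℝ)) ^ 2 ≤ (m : ℝ) ^ 2 := by
      have h1 : (-(m : ℝ)) ≤ (ij.1 : ℝ) := by exact_mod_cast hi1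
      have h2 : (ij.1 : ℝ) ≤ (m : ℝ) := by exact_mod_cast hi2
      nlinarith
    have hj : ((ij.2 : ℝ)) ^ 2 ≤ (m : ℝ) ^ 2 := by
      have h1 : (-(m : ℝ)) ≤ (ij.2 : ℝ) := by exact_mod_cast hj1
      have h2 : (ij.2 : ℝ) ≤ (m : ℝ) := by exact_mod_cast hj2
      nlinarith
    have hp : (37 * (ij.1 : ℝ)) ^ 2 + (37 * (ij.2 : ℝ)) ^ 2 ≤ (ρ - 20) ^ 2 := by nlinarith
    obtain ⟨z, hz, hdeg, hzh, hz1, hz2⟩ := tube_has_payer hg hc X hX A₁ t₁ A₂ t₂ P₁ P₂ R₀ h ρ hR₀ hρ hρ20 hh hP₁X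
      hP₂X hcell hP₁ hP₂ hclean₂ 𝓕 hA₁ havoid hclosed (37 * (ij.1 : ℝ)) (37 * (ij.2 : ℝ)) hp
    exact ⟨z, by rw [hPAY, mem_filter]; exact ⟨hz, hdeg, hz1, hz2⟩, hzh⟩
  choose! f hfP hfd using key
  -- payers of different axes differ
  have hinj : Set.InjOn f ↑G := by
    intro ij hij ij' hij' heq
    have h1 := hfd ij hij
    have h2 := hfd ij' hij'
    rw [heq] at h1
    have a0 : |f ij' 0 - 37 * (ij.1 : ℝ)| ≤ 18 := by
      refine abs_le.2 ⟨?_, ?_⟩ <;> nlinarith [sq_nonneg (f ij' 0 - 37 * (ij.1 : ℝ) + 18),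
        sq_nonneg (f ij' 0 - 37 * (ij.1 : ℝ) - 18), sq_nonneg (f ij' 1 - 37 * (ij.2 : ℝ))]
    have b0 : |f ij' 0 - 37 * (ij'.1 : ℝ)| ≤ 18 := by
      refine abs_le.2 ⟨?_, ?_⟩ <;> nlinarith [sq_nonneg (f ij' 0 - 37 * (ij'.1 : ℝ) + 18),
        sq_nonneg (f ij' 0 - 37 * (ij'.1 : ℝ) - 18), sq_nonneg (f ij' 1 - 37 * (ij'.2 : ℝ))]
    have a1 : |f ij' 1 - 37 * (ij.2 : ℝ)| ≤ 18 := by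
      refine abs_le.2 ⟨?_, ?_⟩ <;> nlinarith [sq_nonneg (f ij' 1 - 37 * (ij.2 : ℝ) + 18),
        sq_nonneg (f ij' 1 - 37 * (ij.2 : ℝ) - 18), sq_nonneg (f ij' 0 - 37 * (ij.1 : ℝ))]
    have b1 : |f ij' 1 - 37 * (ij'.2 : ℝ)| ≤ 18 := by
      refine abs_le.2 ⟨?_, ?_⟩ <;> nlinarith [sq_nonneg (f ij' 1 - 37 * (ij'.2 : ℝ) + 18),
        sq_nonneg (f ij' 1 - 37 * (ij'.2 : ℝ) - 18), sq_nonneg (f ij' 0 - 37 * (ij'.1 : ℝ))]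
    have e1 : ij.1 = ij'.1 := by
      have : |((ij.1 - ij'.1 : ℤ) : ℝ)| < 1 := by
        push_cast
        have := abs_sub_le (37 * (ij.1 : ℝ)) (f ij' 0) (37 * (ij'.1 : ℝ))
        rw [abs_sub_comm] at a0
        have h37 : |37 * (ij.1 : ℝ) - 37 * (ij'.1 : ℝ)| = 37 * |(ij.1 : ℝ) - ij'.1| := by
          rw [← mul_sub, abs_mul]; norm_num
        have : 37 * |(ij.1 : ℝ) - ij'.1| ≤ 36 := by linarith
        linarith
      have hz : (ij.1 - ij'.1 : ℤ) = 0 := Int.abs_lt_one_iff.1 (by exact_mod_cast this)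
      omega
    have e2 : ij.2 = ij'.2 := by
      have : |((ij.2 - ij'.2 : ℤ) : ℝ)| < 1 := by
        push_cast
        have := abs_sub_le (37 * (ij.2 : ℝ)) (f ij' 1) (37 * (ij'.2 : ℝ))
        rw [abs_sub_comm] at a1
        have h37 : |37 * (ij.2 : ℝ) - 37 * (ij'.2 : ℝ)| = 37 * |(ij.2 : ℝ) - ij'.2| := by
          rw [← mul_sub, abs_mul]; norm_num
        have : 37 * |(ij.2 : ℝ) - ij'.2| ≤ 36 := by linarith
        linarith
      have hz : (ij.2 - ij'.2 : ℤ) = 0 := Int.abs_lt_one_iff.1 (by exact_mod_cast this)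
      omega
    exact Prod.ext e1 e2
  rw [← hGcard]
  exact Finset.card_le_card_of_injOn f (fun ij hij => hfP ij hij) hinj

end Summit.Ventures.Crystal3D.Theorems

end
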